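import Literature.Geometry.GeometricMeasureTheory.HausdorffDensity
import Literature.MeasureTheory.Hausdorff.SphericalCap
import Mathlib.Geometry.Euclidean.Volume.Measure
import Mathlib.MeasureTheory.Measure.Haar.InnerProductSpace
import Mathlib.Analysis.Calculus.TangentCone.Seq
import Mathlib.Analysis.Calculus.FDeriv.Basic
import Mathlib.Analysis.SpecificLimits.Basic
import HarnessLib

/-!
# The approximate tangent cone of a chart image is the image of the differential

Brick R4 of the proof of the named fact
`Literature.Geometry.Kaehler.Harvey1977_boundary_toCurrent_eq_zero`: the identification, at
every point of a `C¹` chart image, of Federer's cone of approximate tangent vectors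
`Tan^m(𝓗ᵐ ⌞ C, x)` (`Literature.Geometry.GeometricMeasureTheory.approxTangentCone`) with the
tangent space. Everything is proved from Mathlib, `Currents.lean` and `HausdorffDensity.lean`;
no definitions, no named facts.

* `isClosed_posTangentConeAt` — `Tan(S, x)` is closed.
* `apply_eq_zero_of_mem_posTangentConeAt` — for a level set `S ⊆ {F = F x}` of a map
  differentiable at `x`, `Tan(S, x) ⊆ ker DF(x)`.
* `approxTangentCone_restrict_subset_posTangentConeAt` — `Tan^m(μ ⌞ C, x) ⊆ Tan(C ∩ U, x)` for
  every neighbourhood `U` of `x` (the part of `μ ⌞ C` outside `C ∩ U` vanishes near `x`).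
* `range_fderiv_subset_approxTangentCone` — **the image of the differential consists of
  approximate tangent vectors**: if `g : P → V` (finite-dimensional real inner product spaces,
  `m = dim P`) is Lipschitz on a neighbourhood `W` of `t`, differentiable at `t`, has a
  `1`-Lipschitz left inverse `ℓ` on `W` (`ℓ (g s) = s`), and `g(W) ⊆ C`, then
  `im Dg(t) ⊆ Tan^m(𝓗ᵐ ⌞ C, g t)`. Reason (Federer 3.2.16, 3.2.19): for `v = Dg(t) w` and a set
  `S` off which `𝓗ᵐ ⌞ C` has density `0` at `g t`, the images `g(B(t + r w, ε r))` have
  `𝓗ᵐ`-measure `≥ vol B(t + rw, εr) = (εr)ᵐ vol B₁` (apply the `1`-Lipschitz `ℓ`) inside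
  `B(g t, R r)`, so they meet `S` for all small `r`, at points `g s` with
  `(g s - g t)/r → v` up to `L ε`.
* `approxTangentCone_eq_of_chart` — hence `Tan^m(𝓗ᵐ ⌞ C, g t) = ker DF(g t)` when moreover
  `C ∩ U ⊆ {F = F (g t)}` for a neighbourhood `U` of `g t` and some `F` differentiable at
  `g t` with `ker DF(g t) ⊆ im Dg(t)`.

## References

* H. Federer, *Geometric Measure Theory*, Springer 1969, 3.1.21, 3.2.16, 3.2.19.
-/

noncomputable section

open MeasureTheory MeasureTheory.Measure Set Function Filter Metric Module Topology
open scoped ENNReal NNReal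

namespace Literature.Geometry.GeometricMeasureTheory

/-! ### Tangent cones: closedness and level sets -/

section Cone

variable {V : Type*} [NormedAddCommGroup V] [NormedSpace ℝ V]

/-- The tangent cone `Tan(S, x)` (Mathlib's `posTangentConeAt`, a set of cluster points) is
closed. [cite: Federer1969, 3.1.21] -/
theorem isClosed_posTangentConeAt (S : Set V) (x : V) : IsClosed (posTangentConeAt S x) := by
  rw [posTangentConeAt, tangentConeAt_def]
  exact isClosed_setOf_clusterPt

variable {G : Type*} [NormedAddCommGroup G] [NormedSpace ℝ G]

/-- **Tangent vectors of a level set are killed by the differential**: if `S ⊆ {z | F z = F x}`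
and `F` is differentiable at `x`, then `DF(x) y = 0` for every `y ∈ Tan(S, x)` (for
`c_n (x_n - x) → y` with `x_n ∈ S`: `DF(x) y = lim c_n (F x_n - F x - o(‖x_n - x‖)) = 0`).
[folklore] -/
theorem apply_eq_zero_of_mem_posTangentConeAt {F : V → G} {F' : V →L[ℝ] G} {x : V}
    (hF : HasFDerivAt F F' x) {S : Set V} (hS : S ⊆ {z | F z = F x}) {y : V}
    (hy : y ∈ posTangentConeAt S x) : F' y = 0 := by
  rw [posTangentConeAt, mem_tangentConeAt_iff_exists_seq] at hy
  obtain ⟨c, d, hd0, hds, hcd⟩ := hy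
  have hcd' : Tendsto (fun n => (c n : ℝ) • d n) atTop (𝓝 y) := by
    simpa [NNReal.smul_def] using hcd
  have h1 : Tendsto (fun n => F' ((c n : ℝ) • d n)) atTop (𝓝 (F' y)) :=
    (F'.continuous.tendsto y).comp hcd'
  -- the little-o estimate along `d n`
  have h2 : ∀ ε > 0, ∀ᶠ n in atTop, ‖F' ((c n : ℝ) • d n)‖ ≤ ε * ‖(c n : ℝ) • d n‖ := by
    intro ε hε
    have hx : Tendsto (fun n => x + d n) atTop (𝓝 x) := by
      simpa using tendsto_const_nhds.add hd0
    filter_upwards [hx.eventually (hF.isLittleO.def hε), hds] with n hn hnS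
    have hFS : F (x + d n) = F x := hS hnS
    have : ‖F' (d n)‖ ≤ ε * ‖d n‖ := by
      have h := hn
      simp only [hFS, sub_self, add_sub_cancel_left, zero_sub, norm_neg] at h
      exact h
    calc ‖F' ((c n : ℝ) • d n)‖ = (c n : ℝ) * ‖F' (d n)‖ := by
          rw [map_smul, norm_smul, Real.norm_of_nonneg (c n).coe_nonneg]
      _ ≤ (c n : ℝ) * (ε * ‖d n‖) := by gcongr
      _ = ε * ‖(c n : ℝ) • d n‖ := by
          rw [norm_smul, Real.norm_of_nonneg (c n).coe_nonneg]; ring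
  -- `‖c n • d n‖ → ‖y‖`, so `‖F' y‖ ≤ ε (‖y‖ + 1)` for every `ε > 0`
  have h3 : ∀ ε > 0, ‖F' y‖ ≤ ε * (‖y‖ + 1) := by
    intro ε hε
    have hev : ∀ᶠ n in atTop, ‖(c n : ℝ) • d n‖ ≤ ‖y‖ + 1 :=
      hcd'.norm.eventually (Iic_mem_nhds (lt_add_one _))
    refine le_of_tendsto h1.norm ?_
    filter_upwards [h2 ε hε, hev] with n hn hn'
    exact hn.trans (by gcongr)
  -- hence `F' y = 0`
  by_contra hne
  have hpos : 0 < ‖F' y‖ := norm_pos_iff.2 hne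
  have hy1 : 0 < ‖y‖ + 1 := by positivity
  have := h3 (‖F' y‖ / (2 * (‖y‖ + 1))) (by positivity)
  rw [div_mul_eq_mul_div, le_div_iff₀ (by positivity)] at this
  nlinarith

end Cone

/-! ### Localising the approximate tangent cone -/

section Localise

variable {V : Type*} [NormedAddCommGroup V] [NormedSpace ℝ V] [MeasurableSpace V]
  [OpensMeasurableSpace V] {m : ℕ}

omit [NormedSpace ℝ V] in
/-- The part of `μ ⌞ C` outside `C ∩ U` has upper density `0` at every interior point of `U`
(it vanishes on small balls). [cite: Federer1969, 3.2.16] -/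
theorem upperDensity_restrict_compl_inter_eq_zero (μ : Measure V) {C U : Set V}
    (hC : MeasurableSet C) (hUm : MeasurableSet U) {x : V} (hU : U ∈ 𝓝 x) :
    upperDensity m ((μ.restrict C).restrict (C ∩ U)ᶜ) x = 0 := by
  obtain ⟨ρ, hρ, hball⟩ := Metric.mem_nhds_iff.1 hU
  have hev : ∀ᶠ r in 𝓝[>] (0 : ℝ), ((μ.restrict C).restrict (C ∩ U)ᶜ) (closedBall x r) /
      (unitBallVolume m * ENNReal.ofReal (r ^ m)) = 0 := by
    have : ∀ᶠ r in 𝓝[>] (0 : ℝ), r < ρ := mem_nhdsWithin_of_mem_nhds (Iio_mem_nhds hρ)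
    filter_upwards [this] with r hr
    have h0 : ((μ.restrict C).restrict (C ∩ U)ᶜ) (closedBall x r) = 0 := by
      rw [restrict_restrict (hC.inter hUm).compl, Measure.restrict_apply measurableSet_closedBall]
      have : closedBall x r ∩ ((C ∩ U)ᶜ ∩ C) = ∅ := by
        refine eq_empty_iff_forall_notMem.2 fun z ⟨hz, hzCU, hzC⟩ => hzCU ⟨hzC, ?_⟩
        exact hball (closedBall_subset_ball hr hz)
      rw [this, measure_empty]
    rw [h0, ENNReal.zero_div]
  unfold upperDensity
  rw [limsup_congr hev]
  exact limsup_const 0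

/-- **Localisation**: `Tan^m(μ ⌞ C, x) ⊆ Tan(C ∩ U, x)` for every measurable neighbourhood `U`
of `x` and measurable `C`. [cite: Federer1969, 3.2.16] -/
theorem approxTangentCone_restrict_subset_posTangentConeAt (μ : Measure V) {C U : Set V}
    (hC : MeasurableSet C) (hUm : MeasurableSet U) {x : V} (hU : U ∈ 𝓝 x) :
    approxTangentCone m (μ.restrict C) x ⊆ posTangentConeAt (C ∩ U) x := fun _ hy =>
  (mem_iInter₂.1 hy) (C ∩ U) (upperDensity_restrict_compl_inter_eq_zero μ hC hUm hU)

end Localise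

/-! ### The image of the differential of a chart consists of approximate tangent vectors -/

section Chart

variable {P : Type*} [NormedAddCommGroup P] [InnerProductSpace ℝ P] [FiniteDimensional ℝ P]
  [MeasurableSpace P] [BorelSpace P]
  {V : Type*} [NormedAddCommGroup V] [NormedSpace ℝ V] [MeasurableSpace V] [BorelSpace V]

omit [NormedSpace ℝ V] in
/-- **Lower volume bound for chart images.** If `ℓ : V → P` is `1`-Lipschitz and `ℓ (g s) = s`
on `B ⊆ P`, then `𝓗ᵐ(g(B)) ≥ vol(B)`, `m = dim P`. [folklore] -/
theorem volume_le_euclideanHausdorffMeasure_image {ℓ : V → P} (hℓ : LipschitzWith 1 ℓ) {g : P → V}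
    {B : Set P} (hℓg : ∀ s ∈ B, ℓ (g s) = s) :
    volume B ≤ μHE[finrank ℝ P] (g '' B) := by
  have himage : ℓ '' (g '' B) = B := by
    rw [image_image]
    exact (image_congr fun s hs => hℓg s hs).trans (image_id' B)
  have := (hℓ.lipschitzOnWith (s := g '' B)).euclideanHausdorffMeasure_image_le (finrank ℝ P)
  rw [himage, ENNReal.coe_one, one_pow, one_mul,
    InnerProductSpace.euclideanHausdorffMeasure_eq_volume] at this
  exact this

/-- **The image of the differential of a chart lies in the approximate tangent cone.** Let
`g : P → V` be Lipschitz on a neighbourhood `W` of `t`, differentiable at `t`, with a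
`1`-Lipschitz left inverse `ℓ` on `W`, and `g(W) ⊆ C`. Then
`im Dg(t) ⊆ Tan^m(𝓗ᵐ ⌞ C, g t)`, `m = dim P` (Federer: `Tan^m` of a Lipschitz image contains
the image of the differential at almost every point, 3.2.19; here at the given point, thanks
to the left inverse). [cite: Federer1969, 3.2.19] -/
theorem range_fderiv_subset_approxTangentCone {ℓ : V → P} (hℓ : LipschitzWith 1 ℓ) {g : P → V}
    {W : Set P} {t : P} (hW : W ∈ 𝓝 t) {L : ℝ≥0} (hg : LipschitzOnWith L g W)
    (hℓg : ∀ s ∈ W, ℓ (g s) = s) {g' : P →L[ℝ] V} (hd : HasFDerivAt g g' t)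
    {C : Set V} (hC : g '' W ⊆ C) :
    (range g' : Set V) ⊆
      approxTangentCone (finrank ℝ P) ((μHE[finrank ℝ P] : Measure V).restrict C) (g t) := by
  rintro _ ⟨w, rfl⟩
  refine mem_iInter₂.2 fun S hS => ?_
  have htW : t ∈ W := mem_of_mem_nhds hW
  obtain ⟨ρ₀, hρ₀, hballW⟩ := Metric.mem_nhds_iff.1 hW
  -- the constant `R = L (‖w‖ + 1) + 1`, bounding `‖g s - g t‖ ≤ R r` on `B(t + r w, ε r)`
  set R : ℝ := L * (‖w‖ + 1) + 1 with hR
  have hRpos : 0 < R := by positivity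
  have hR1 : (L : ℝ) * (‖w‖ + 1) ≤ R := by linarith
  -- the ratio `μ'(𝐁(g t, R r)) / (α (R r)ᵐ)` tends to `0`
  set μ' : Measure V := (((μHE[finrank ℝ P] : Measure V).restrict C).restrict Sᶜ) with hμ'
  have hT : Tendsto (fun r : ℝ => μ' (closedBall (g t) (R * r)) /
      (unitBallVolume (finrank ℝ P) * ENNReal.ofReal ((R * r) ^ finrank ℝ P))) (𝓝[>] 0)
      (𝓝 0) := by
    have h1 := tendsto_of_upperDensity_eq_zero hS
    have h2 : Tendsto (fun r : ℝ => R * r) (𝓝[>] 0) (𝓝[>] 0) := by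
      refine tendsto_nhdsWithin_of_tendsto_nhds_of_eventually_within _ ?_ ?_
      · exact ((by fun_prop : Continuous fun r : ℝ => R * r).tendsto' 0 0 (by simp)).mono_left
          nhdsWithin_le_nhds
      · filter_upwards [self_mem_nhdsWithin] with r hr using mul_pos hRpos hr
    exact h1.comp h2
  -- Step 1: for every `ε ∈ (0, 1]`, for all small `r > 0` there is `s ∈ B(t + r w, ε r)` with
  -- `g s ∈ S`
  have key : ∀ ε : ℝ, 0 < ε → ε ≤ 1 → ∀ᶠ r in 𝓝[>] (0 : ℝ),
      ball (t + r • w) (ε * r) ⊆ W ∧ ∃ s ∈ ball (t + r • w) (ε * r), g s ∈ S := by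
    intro ε hε hε1
    -- the positive constant `κ = (ε/R)ᵐ vol(B₁) / α(m)`
    set κ : ℝ≥0∞ := ENNReal.ofReal ((ε / R) ^ finrank ℝ P) * volume (ball (0 : P) 1) /
      unitBallVolume (finrank ℝ P) with hκ
    have hκpos : 0 < κ := by
      rw [hκ]
      refine ENNReal.div_pos (mul_ne_zero ?_ (measure_ball_pos volume _ one_pos).ne')
        (unitBallVolume_ne_top _)
      exact (ENNReal.ofReal_pos.2 (by positivity)).ne'
    have e1 : ∀ᶠ r in 𝓝[>] (0 : ℝ), μ' (closedBall (g t) (R * r)) /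
        (unitBallVolume (finrank ℝ P) * ENNReal.ofReal ((R * r) ^ finrank ℝ P)) < κ :=
      hT.eventually_lt_const hκpos
    have e2 : ∀ᶠ r in 𝓝[>] (0 : ℝ), r * (‖w‖ + 1) < ρ₀ := by
      have : Tendsto (fun r : ℝ => r * (‖w‖ + 1)) (𝓝 0) (𝓝 0) :=
        (by fun_prop : Continuous fun r : ℝ => r * (‖w‖ + 1)).tendsto' 0 0 (by simp)
      exact mem_nhdsWithin_of_mem_nhds (this.eventually (gt_mem_nhds hρ₀))
    filter_upwards [e1, e2, self_mem_nhdsWithin] with r hr1 hr2 (hr : 0 < r)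
    -- the ball `B = B(t + r w, ε r)` lies in `W`
    have hBW : ball (t + r • w) (ε * r) ⊆ W := by
      refine fun s hs => hballW ?_
      rw [mem_ball, dist_eq_norm] at hs ⊢
      calc ‖s - t‖ = ‖(s - (t + r • w)) + r • w‖ := by congr 1; abel
        _ ≤ ‖s - (t + r • w)‖ + ‖r • w‖ := norm_add_le _ _
        _ < ε * r + r * ‖w‖ := by
            rw [norm_smul, Real.norm_of_nonneg hr.le]; gcongr
        _ ≤ r * (‖w‖ + 1) := by nlinarith
        _ < ρ₀ := hr2
    refine ⟨hBW, ?_⟩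
    -- if `g(B)` missed `S`, the ratio at radius `R r` would be `≥ κ`
    by_contra hno
    push Not at hno
    have hsub : g '' ball (t + r • w) (ε * r) ⊆ closedBall (g t) (R * r) ∩ (Sᶜ ∩ C) := by
      rintro _ ⟨s, hs, rfl⟩
      refine ⟨?_, hno s hs, hC (mem_image_of_mem g (hBW hs))⟩
      rw [mem_closedBall, dist_eq_norm]
      have h1 : ‖g s - g t‖ ≤ L * ‖s - t‖ := by
        rw [← dist_eq_norm, ← dist_eq_norm]; exact hg.dist_le_mul s (hBW hs) t htW
      have h2 : ‖s - t‖ ≤ r * (‖w‖ + 1) := by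
        rw [mem_ball, dist_eq_norm] at hs
        calc ‖s - t‖ = ‖(s - (t + r • w)) + r • w‖ := by congr 1; abel
          _ ≤ ‖s - (t + r • w)‖ + ‖r • w‖ := norm_add_le _ _
          _ ≤ ε * r + r * ‖w‖ := by
              rw [norm_smul, Real.norm_of_nonneg hr.le]; exact add_le_add hs.le le_rfl
          _ ≤ r * (‖w‖ + 1) := by nlinarith
      calc ‖g s - g t‖ ≤ L * ‖s - t‖ := h1
        _ ≤ L * (r * (‖w‖ + 1)) := by gcongr
        _ = L * (‖w‖ + 1) * r := by ring
        _ ≤ R * r := by gcongr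
    -- lower bound for `μ'(𝐁(g t, R r))`
    have hlow : ENNReal.ofReal ((ε * r) ^ finrank ℝ P) * volume (ball (0 : P) 1) ≤
        μ' (closedBall (g t) (R * r)) := by
      calc ENNReal.ofReal ((ε * r) ^ finrank ℝ P) * volume (ball (0 : P) 1)
          = volume (ball (t + r • w) (ε * r)) :=
            (addHaar_ball_of_pos (volume : Measure P) (t + r • w)
              (by positivity : (0 : ℝ) < ε * r)).symm
        _ ≤ μHE[finrank ℝ P] (g '' ball (t + r • w) (ε * r)) :=
            volume_le_euclideanHausdorffMeasure_image hℓ fun s hs => hℓg s (hBW hs)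
        _ = μHE[finrank ℝ P] (g '' ball (t + r • w) (ε * r) ∩ (Sᶜ ∩ C)) := by
            rw [inter_eq_self_of_subset_left fun z hz => (hsub hz).2]
        _ = μHE[finrank ℝ P] ((g '' ball (t + r • w) (ε * r) ∩ Sᶜ) ∩ C) := by rw [inter_assoc]
        _ ≤ ((μHE[finrank ℝ P] : Measure V).restrict C) (g '' ball (t + r • w) (ε * r) ∩ Sᶜ) :=
            le_restrict_apply _ _
        _ ≤ μ' (g '' ball (t + r • w) (ε * r)) := le_restrict_apply _ _
        _ ≤ μ' (closedBall (g t) (R * r)) := measure_mono fun z hz => (hsub hz).1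
    -- hence the ratio is `≥ κ`
    have hratio : κ ≤ μ' (closedBall (g t) (R * r)) /
        (unitBallVolume (finrank ℝ P) * ENNReal.ofReal ((R * r) ^ finrank ℝ P)) := by
      rw [ENNReal.le_div_iff_mul_le (Or.inl (mul_ne_zero (unitBallVolume_ne_zero _)
          (ENNReal.ofReal_pos.2 (by positivity)).ne'))
        (Or.inl (ENNReal.mul_ne_top (unitBallVolume_ne_top _) ENNReal.ofReal_ne_top))]
      calc κ * (unitBallVolume (finrank ℝ P) * ENNReal.ofReal ((R * r) ^ finrank ℝ P))
          = ENNReal.ofReal ((ε / R) ^ finrank ℝ P) * volume (ball (0 : P) 1) *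
              ENNReal.ofReal ((R * r) ^ finrank ℝ P) := by
            rw [hκ, ← mul_assoc, ENNReal.div_mul_cancel (unitBallVolume_ne_zero _)
              (unitBallVolume_ne_top _)]
        _ = ENNReal.ofReal ((ε * r) ^ finrank ℝ P) * volume (ball (0 : P) 1) := by
            rw [mul_assoc, mul_comm (volume _), ← mul_assoc, ← ENNReal.ofReal_mul
              (by positivity)]
            congr 2
            rw [← mul_pow]
            congr 1
            field_simp
        _ ≤ μ' (closedBall (g t) (R * r)) := hlow
    exact absurd hr1 (not_lt.2 hratio)
  -- Step 2: extract sequences `r n → 0⁺`, `s n ∈ B(t + r n • w, r n / (n+1))`, `g (s n) ∈ S`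
  have hseq : ∀ n : ℕ, ∃ r : ℝ, 0 < r ∧ r < 1 / (n + 1) ∧ ball (t + r • w) (1 / (n + 1) * r) ⊆ W ∧
      ∃ s ∈ ball (t + r • w) (1 / (n + 1) * r), g s ∈ S := fun n => by
    have hn : (0 : ℝ) < 1 / (n + 1) := Nat.one_div_pos_of_nat
    have hn1 : (1 : ℝ) / (n + 1) ≤ 1 := by
      rw [div_le_one (by positivity)]; linarith [n.cast_nonneg (α := ℝ)]
    have e : ∀ᶠ r : ℝ in 𝓝[>] 0, r < 1 / (n + 1) :=
      mem_nhdsWithin_of_mem_nhds (Iio_mem_nhds hn)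
    obtain ⟨r, ⟨⟨hBW, s, hs, hgs⟩, hr⟩, hrpos⟩ :=
      (((key _ hn hn1).and e).and (self_mem_nhdsWithin : Ioi (0 : ℝ) ∈ 𝓝[>] (0 : ℝ))).exists
    exact ⟨r, hrpos, hr, hBW, s, hs, hgs⟩
  choose r hrpos hrlt hBW s hs hgs using hseq
  -- `r n → 0`
  have hr0 : Tendsto r atTop (𝓝 0) := by
    refine squeeze_zero (fun n => (hrpos n).le) (fun n => (hrlt n).le) ?_
    exact tendsto_one_div_add_atTop_nhds_zero_nat
  -- distances: `‖s n - (t + r n • w)‖ < r n / (n+1)` and `‖s n - t‖ ≤ r n (‖w‖ + 1)`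
  have hdist1 : ∀ n, ‖s n - (t + r n • w)‖ ≤ 1 / (n + 1) * r n := fun n => by
    have := hs n
    rw [mem_ball, dist_eq_norm] at this
    exact this.le
  have hsW : ∀ n, s n ∈ W := fun n => hBW n (hs n)
  have htrW : ∀ n, t + r n • w ∈ W := fun n => hBW n (mem_ball_self (by
    have := hrpos n; positivity))
  -- the sequences for `mem_tangentConeAt_of_seq`
  set d : ℕ → V := fun n => g (s n) - g t with hd_def
  set c : ℕ → ℝ≥0 := fun n => ⟨(r n)⁻¹, inv_nonneg.2 (hrpos n).le⟩ with hc_def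
  have hcr : ∀ n, ((c n : ℝ≥0) : ℝ) = (r n)⁻¹ := fun n => rfl
  -- (a) `d n → 0`
  have hd0 : Tendsto d atTop (𝓝 0) := by
    rw [tendsto_zero_iff_norm_tendsto_zero]
    have hbound : ∀ n, ‖d n‖ ≤ L * ((1 / (n + 1) + ‖w‖) * r n) := fun n => by
      calc ‖d n‖ = dist (g (s n)) (g t) := by rw [hd_def, dist_eq_norm]
        _ ≤ L * dist (s n) t := hg.dist_le_mul _ (hsW n) _ htW
        _ ≤ L * ((1 / (n + 1) + ‖w‖) * r n) := by
            gcongr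
            rw [dist_eq_norm]
            calc ‖s n - t‖ = ‖(s n - (t + r n • w)) + r n • w‖ := by congr 1; abel
              _ ≤ ‖s n - (t + r n • w)‖ + ‖r n • w‖ := norm_add_le _ _
              _ ≤ 1 / (n + 1) * r n + r n * ‖w‖ := by
                  rw [norm_smul, Real.norm_of_nonneg (hrpos n).le]
                  exact add_le_add (hdist1 n) le_rfl
              _ = (1 / (n + 1) + ‖w‖) * r n := by ring
    have hlim : Tendsto (fun n : ℕ => (L : ℝ) * ((1 / (n + 1) + ‖w‖) * r n)) atTop (𝓝 0) := by
      have : Tendsto (fun n : ℕ => (1 / ((n : ℝ) + 1) + ‖w‖) * r n) atTop (𝓝 ((0 + ‖w‖) * 0)) :=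
        (tendsto_one_div_add_atTop_nhds_zero_nat.add tendsto_const_nhds).mul hr0
      simpa using this.const_mul (L : ℝ)
    exact squeeze_zero (fun n => norm_nonneg _) hbound hlim
  -- (b) `g t + d n ∈ S`
  have hdS : ∀ᶠ n in atTop, g t + d n ∈ S := Eventually.of_forall fun n => by
    simpa [hd_def] using hgs n
  -- (c) `c n • d n → g' w`
  have hcd : Tendsto (fun n => c n • d n) atTop (𝓝 (g' w)) := by
    have hsplit : ∀ n, (c n • d n : V) =
        (r n)⁻¹ • (g (s n) - g (t + r n • w)) + (r n)⁻¹ • (g (t + r n • w) - g t) := fun n => by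
      rw [NNReal.smul_def, hcr, hd_def, ← smul_add]
      congr 1
      abel
    simp_rw [hsplit]
    rw [← zero_add (g' w)]
    refine Tendsto.add ?_ ?_
    · -- `‖(r n)⁻¹ • (g (s n) - g (t + r n • w))‖ ≤ L / (n+1) → 0`
      rw [tendsto_zero_iff_norm_tendsto_zero]
      have hbound : ∀ n, ‖(r n)⁻¹ • (g (s n) - g (t + r n • w))‖ ≤ L * (1 / (n + 1)) := fun n => by
        rw [norm_smul, norm_inv, Real.norm_of_nonneg (hrpos n).le]
        have h1 : ‖g (s n) - g (t + r n • w)‖ ≤ L * ‖s n - (t + r n • w)‖ := by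
          rw [← dist_eq_norm, ← dist_eq_norm]; exact hg.dist_le_mul _ (hsW n) _ (htrW n)
        calc (r n)⁻¹ * ‖g (s n) - g (t + r n • w)‖ ≤ (r n)⁻¹ * (L * (1 / (n + 1) * r n)) :=
              mul_le_mul_of_nonneg_left
                (h1.trans (mul_le_mul_of_nonneg_left (hdist1 n) L.coe_nonneg))
                (inv_nonneg.2 (hrpos n).le)
          _ = L * (1 / (n + 1)) := by field_simp [(hrpos n).ne']
      have hlim : Tendsto (fun n : ℕ => (L : ℝ) * (1 / ((n : ℝ) + 1))) atTop (𝓝 0) := by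
        simpa using (tendsto_one_div_add_atTop_nhds_zero_nat.const_mul (L : ℝ))
      exact squeeze_zero (fun n => norm_nonneg _) hbound hlim
    · -- the difference quotient along `w`
      have hc' : Tendsto (fun n => ‖(r n)⁻¹‖) atTop atTop := by
        simp_rw [norm_inv, Real.norm_of_nonneg (hrpos _).le]
        exact (tendsto_inv_nhdsGT_zero.comp (tendsto_nhdsWithin_iff.2
          ⟨hr0, Eventually.of_forall fun n => hrpos n⟩))
      have := hd.lim w hc'
      simpa [inv_inv] using this
  exact mem_tangentConeAt_of_seq atTop c d hd0 hdS hcd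

variable {G : Type*} [NormedAddCommGroup G] [NormedSpace ℝ G]

/-- **The approximate tangent cone of a chart image is the tangent space.** In the situation of
`range_fderiv_subset_approxTangentCone`, suppose moreover that `C` is measurable and that near
`g t` the set `C` lies in a level set `{F = F (g t)}` of a map `F` differentiable at `g t` whose
differential kills only vectors of `im Dg(t)` (`ker DF(g t) ⊆ im Dg(t)`). Then
`Tan^m(𝓗ᵐ ⌞ C, g t) = im Dg(t)`. [cite: Federer1969, 3.2.19] -/
theorem approxTangentCone_eq_range_fderiv {ℓ : V → P} (hℓ : LipschitzWith 1 ℓ) {g : P → V}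
    {W : Set P} {t : P} (hW : W ∈ 𝓝 t) {L : ℝ≥0} (hg : LipschitzOnWith L g W)
    (hℓg : ∀ s ∈ W, ℓ (g s) = s) {g' : P →L[ℝ] V} (hd : HasFDerivAt g g' t)
    {C : Set V} (hC : g '' W ⊆ C) (hCm : MeasurableSet C)
    {U : Set V} (hUm : MeasurableSet U) (hU : U ∈ 𝓝 (g t))
    {F : V → G} {F' : V →L[ℝ] G} (hF : HasFDerivAt F F' (g t))
    (hCU : C ∩ U ⊆ {z | F z = F (g t)}) (hker : ∀ y, F' y = 0 → y ∈ range g') :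
    approxTangentCone (finrank ℝ P) ((μHE[finrank ℝ P] : Measure V).restrict C) (g t) =
      range g' := by
  refine Subset.antisymm (fun y hy => hker y ?_) (range_fderiv_subset_approxTangentCone hℓ hW hg
    hℓg hd hC)
  exact apply_eq_zero_of_mem_posTangentConeAt hF hCU
    (approxTangentCone_restrict_subset_posTangentConeAt _ hCm hUm hU hy)

end Chart

end Literature.Geometry.GeometricMeasureTheory
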